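import Literature.AlgebraicGeometry.GroupSchemes.FullSetOfSectionsCriteria
import HarnessLib

/-!
# Full sets of sections — Cayley–Hamilton consequences: every section meets the list; rigidity over a domain

Topic `AlgebraicGeometry/GroupSchemes`; namespace `Literature.AlgebraicGeometry.GroupSchemes`; continues ★
`FullSetOfSections` (`IsFullSetOfSections`, [KatzMazur1985, §1.8 (1.8.2)]) and ★ `FullSetOfSectionsCriteria`
(`isFullSetOfSections_iff_charpoly_eq`).  Fully proved theorems only: **no def, no named fact, no `sorry`, no instance,
no notation**.  Cell `pub/hodgecm-mathlib`, programme P6 («MOD»), generic organ L5.1 (file 3).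

## Mathematics

Let `(Pᵢ)_{i ∈ J}` be a full set of sections of `Spec A → Spec R`, `A` finite free over `R` [KatzMazur1985, §1.8].
The characteristic-polynomial form says that for every `g ∈ R′ ⊗_R A` the characteristic polynomial of `g·` is
`∏ᵢ (X − P_{i,R′}(g))`; by CAYLEY–HAMILTON it annihilates `g`:  `∏ᵢ (g − P_{i,R′}(g)) = 0` in `R′ ⊗_R A`.  Applying
a further section `Q′` gives `∏ᵢ (Q′(g) − P_{i,R′}(g)) = 0` in `R′`: «every section meets the list».  Over an
integral DOMAIN `R` this rigidifies to: every section `Q` of `Spec A → Spec R` IS one of the `Pᵢ` (take `g` the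
generic element `∑ X_j ⊗ e_j` over the domain `R[X_j : j]` and compare the linear forms `Q(ξ)`, `Pᵢ(ξ)`).

## Contents
* `IsFullSetOfSections.prod_sub_algebraMap_pointBaseChange_eq_zero` — `∏ᵢ (g − P_{i,R′}(g)·1) = 0`.
* `IsFullSetOfSections.prod_apply_sub_pointBaseChange_eq_zero` — `∏ᵢ (Q′ g − P_{i,R′} g) = 0` for any section
  `Q′` after base change; `IsFullSetOfSections.prod_apply_sub_apply_eq_zero` — the case `R′ = R`, on `A` itself.
* **`IsFullSetOfSections.exists_eq_of_isDomain`** — `R` a domain, `A` with a finite basis: every section is some `Pᵢ`.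

## References
* [KatzMazur1985] N. M. Katz, B. Mazur, *Arithmetic Moduli of Elliptic Curves*, Ann. of Math. Stud. 108 (1985), §1.8
  (1.8.2) (full sets of sections; characteristic-polynomial form).
-/

set_option autoImplicit false

noncomputable section

open scoped TensorProduct

universe u

/-! ## §8 Cayley–Hamilton consequences: every section meets the list, and rigidity over a domain -/

namespace Literature.AlgebraicGeometry.GroupSchemes

section CayleyHamilton

variable {R A : Type u} [CommRing R] [CommRing A] [Algebra R A] {J : Type} [Fintype J] {P : J → (A →ₐ[R] R)}

open Polynomial in
/-- **`∏ᵢ (g − P_{i,R′}(g)) = 0` in `R′ ⊗_R A`** for a full set of sections `(Pᵢ)` of a finite free `A` and every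
`g` after any base change: the characteristic polynomial of `g·` is `∏ᵢ (X − P_{i,R′}(g))` (★
`isFullSetOfSections_iff_charpoly_eq`) and annihilates `g` by Cayley–Hamilton (Mathlib
`LinearMap.aeval_self_charpoly`). [cite: KatzMazur1985, §1.8 (1.8.2)] -/
theorem IsFullSetOfSections.prod_sub_algebraMap_pointBaseChange_eq_zero [Module.Free R A] [Module.Finite R A]
    (hP : IsFullSetOfSections P) (R' : Type u) [CommRing R'] [Algebra R R'] (g : R' ⊗[R] A) :
    ∏ i, (g - algebraMap R' (R' ⊗[R] A) ((P i).pointBaseChange R' g)) = 0 := by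
  have hχ := (isFullSetOfSections_iff_charpoly_eq P).mp hP R' g
  have hCH := LinearMap.aeval_self_charpoly (Algebra.lmul R' (R' ⊗[R] A) g)
  rw [hχ, aeval_algHom_apply, map_prod] at hCH
  have h1 := LinearMap.congr_fun hCH 1
  rw [LinearMap.zero_apply, Algebra.coe_lmul_eq_mul, LinearMap.mul_apply', mul_one] at h1
  rw [← h1]
  exact Finset.prod_congr rfl fun i _ => by simp

/-- **Every section meets the list**: if `(Pᵢ)` is a full set of sections of a finite free `A` then for every further
section `Q′` of `Spec (R′ ⊗_R A) → Spec R′` and every `g`, `∏ᵢ (Q′(g) − P_{i,R′}(g)) = 0` in `R′` (apply `Q′` to ★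
`prod_sub_algebraMap_pointBaseChange_eq_zero`). [cite: KatzMazur1985, §1.8 (1.8.2)] -/
theorem IsFullSetOfSections.prod_apply_sub_pointBaseChange_eq_zero [Module.Free R A] [Module.Finite R A]
    (hP : IsFullSetOfSections P) (R' : Type u) [CommRing R'] [Algebra R R'] (Q' : R' ⊗[R] A →ₐ[R'] R')
    (g : R' ⊗[R] A) : ∏ i, (Q' g - (P i).pointBaseChange R' g) = 0 := by
  have h := congr_arg Q' (hP.prod_sub_algebraMap_pointBaseChange_eq_zero R' g)
  rw [map_prod, map_zero] at h
  rw [← h]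
  exact Finset.prod_congr rfl fun i _ => by rw [map_sub, AlgHom.commutes, Algebra.algebraMap_self, RingHom.id_apply]

/-- The same over `R` itself: for a full set of sections `(Pᵢ)` of a finite free `A`, any section `Q : A → R` and any
`a ∈ A`, `∏ᵢ (Q(a) − Pᵢ(a)) = 0`. [cite: KatzMazur1985, §1.8 (1.8.2)] -/
theorem IsFullSetOfSections.prod_apply_sub_apply_eq_zero [Module.Free R A] [Module.Finite R A]
    (hP : IsFullSetOfSections P) (Q : A →ₐ[R] R) (a : A) : ∏ i, (Q a - P i a) = 0 := by
  have h := hP.prod_apply_sub_pointBaseChange_eq_zero R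
    (Q.comp (Algebra.TensorProduct.lid R A : R ⊗[R] A →ₐ[R] A)) ((Algebra.TensorProduct.lid R A).symm a)
  rw [← h]
  exact Finset.prod_congr rfl fun i _ => by simp [Algebra.TensorProduct.lid_symm_apply]

open MvPolynomial in
/-- **Rigidity over an integral domain**: if `R` is a domain, `A` has a finite `R`-basis and `(Pᵢ)` is a full set of
sections, then EVERY section `Q : A → R` is one of the `Pᵢ`.  (Over the domain `R[X_j : j]` the generic element
`ξ = ∑ X_j ⊗ e_j` satisfies `∏ᵢ (Q(ξ) − Pᵢ(ξ)) = 0` by ★ `prod_apply_sub_pointBaseChange_eq_zero`, so some factor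
vanishes; comparing the coefficients of the linear forms `Q(ξ) = ∑ Q(e_j) X_j`, `Pᵢ(ξ) = ∑ Pᵢ(e_j) X_j` gives
`Q = Pᵢ` on the basis.) [cite: KatzMazur1985, §1.8 (1.8.2)] -/
theorem IsFullSetOfSections.exists_eq_of_isDomain [IsDomain R] {ι : Type} [Fintype ι] (e : Module.Basis ι R A)
    (hP : IsFullSetOfSections P) (Q : A →ₐ[R] R) : ∃ i, P i = Q := by
  classical
  haveI : Module.Free R A := Module.Free.of_basis e
  haveI : Module.Finite R A := Module.Finite.of_basis e
  set ξ : MvPolynomial ι R ⊗[R] A := ∑ j, (X j : MvPolynomial ι R) ⊗ₜ[R] e j with hξ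
  -- the linear forms `S(ξ) = ∑ S(e_j) X_j`
  have hlin : ∀ S : A →ₐ[R] R, S.pointBaseChange (MvPolynomial ι R) ξ = ∑ j, C (S (e j)) * X j := by
    intro S
    rw [hξ, map_sum]
    exact Finset.sum_congr rfl fun j _ => by rw [AlgHom.pointBaseChange_tmul, MvPolynomial.algebraMap_eq, mul_comm]
  have hcoeff : ∀ (S : A →ₐ[R] R) (j : ι), coeff (Finsupp.single j 1) (∑ k, C (S (e k)) * X k) = S (e j) := by
    intro S j
    rw [coeff_sum, Finset.sum_eq_single j (fun k _ hk => ?_) (fun h => (h (Finset.mem_univ j)).elim),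
      coeff_C_mul, coeff_X_same, mul_one]
    rw [coeff_C_mul, coeff_X, if_neg, mul_zero]
    exact fun h => hk (Finsupp.single_left_injective one_ne_zero h)
  -- some factor of `∏ᵢ (Q(ξ) − Pᵢ(ξ))` vanishes in the domain `R[X]`
  have h0 := hP.prod_apply_sub_pointBaseChange_eq_zero (MvPolynomial ι R)
    (Q.pointBaseChange (MvPolynomial ι R)) ξ
  obtain ⟨i, -, hi⟩ := Finset.prod_eq_zero_iff.mp h0
  refine ⟨i, ?_⟩
  rw [sub_eq_zero, hlin, hlin] at hi
  apply AlgHom.toLinearMap_injective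
  refine e.ext fun j => ?_
  have := congr_arg (coeff (Finsupp.single j 1)) hi
  rw [hcoeff, hcoeff] at this
  simpa using this.symm

end CayleyHamilton

end Literature.AlgebraicGeometry.GroupSchemes

end
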